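/-
Copyright (c) 2026 the pub-hodgecm-mathlib formalisation cell (harness21).  Prover seat hodgecm-mathlib-F0P3-p02 (g26), 2026-09-03.  E1 row 34 (offered) «SCHNEIDER–STUHLER
TREE COMPLEX: EXACT AT `C₀` (and `H₁ = 0`) GIVEN (U6)+(U7)» (census «E1 ∕ KAZHDAN-IN-HOUSE» v1 §2-K1 (R); E1 keeper ∕ dealer F0P3a-p03 (g29)).
-/
import Literature.NumberTheory.Automorphic.CompactOpenAveragingCompose     -- ★ row 33: `avgProj_avgProj_eq_avgProj_sup` ((U6) composition), `avgProj_avgProj_eq_avgProj_of_subset_mul` ((U7) collapse), `avgProj_mem_fixedPoints`, `avgProj_of_mem_fixedPoints`, `avgProj_finset_sum`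
import Literature.Combinatorics.SimpleGraph.TreeDescendantPartition         -- ★ `TreeLayers.exists_rooted_parent` (parent map of a rooted tree: (P2) parent step, (P5) children, shadow ↔ descendant)
import Literature.Combinatorics.SimpleGraph.AcyclicBoundaryInjective        -- ★ `Orientation`, `incMatrix` (the boundary `u ↦ Σ_e D_{ue} • c e`), `finsupp_boundary_injective_of_isAcyclic` (`H₁ = 0` on a forest)
import HarnessLib

/-!
# The Schneider–Stuhler complex of a smooth representation on a TREE is exact at `C₀` (and at `C₁`): `Σ_x v_x = 0`, `v_x ∈ V^{U_x}` ⇒ `(v_x) = ∂c` with `c_e ∈ V^{U_e}`,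
# for vertex groups satisfying (U6) `U_{{x,y}} = U_x U_y` and (U7) `U_y ⊆ U_x U_z` (`y` on the geodesic `[x, z]`)

Topic `NumberTheory/Automorphic` (declarations in Mathlib's `Representation` namespace, dot-style, as ★ row 23 `SmoothFixedVectorGeneration` and ★ row 33
`CompactOpenAveragingCompose`).  THEOREMS ONLY (no definition, no instance, no notation, no named fact, no `sorry`).  Cell `pub/hodgecm-mathlib` (D-0151),
crux H413 = `stmt-HodgeConjecture-24833`, lane `--supports`; census «E1 ∕ KAZHDAN-IN-HOUSE» v1 §2-K1 (R) («EXACTNESS AT `C_0` is the theorem [SS97 II.3.1] — L∕XL»).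
HONEST LABEL: count-neutral GENERIC base layer of the (R-SS) resolution engine — (U6) and (U7) are HYPOTHESES here (the datum `U(Φ₃)_v` owes (U7) in the lattice
model, [SS97 Prop. I.3.2]); HC_CM is proved only modulo the 2 remaining named inputs (hLiu418 = `stmt-HodgeConjecture-24832`, h413 = `stmt-HodgeConjecture-24833`)
until rung 0 closes; nothing printed is asserted here beyond what is proved.

THE MATHEMATICS ([SS97 II.3.1] for a tree; [MeyerSolleveld2010] Thm. 2.4 for the form «every smooth `V`»).  `Γ` a topological group, `ρ` a representation of `Γ` on a
`k`-space `V` (`char k = 0`), `G` a TREE on the vertex type `ι`, `U : ι → Subgroup Γ` COMPACT vertex groups with (U6) `↑(U_x ⊔ U_y) = U_x · U_y` for adjacent `x, y`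
(the edge group) and (U7) `U_y ⊆ U_x · U_z` whenever `x ~ y` and `dist(y, z) + 1 = dist(x, z)` (`y` is the first step of the geodesic from `x` to `z`).  The
`0`-chains are finitely supported `v : ι →₀ V` with `v_x ∈ V^{U_x}` smooth; the `1`-chains `c : G.edgeSet →₀ V` with `c_e ∈ V^{U_{head e} ⊔ U_{tail e}}` smooth; for an
orientation `σ` the boundary is `(∂c)_u = Σ_e D_{ue} • c_e` (★ `OrientedIncidence.Orientation.incMatrix`: `+1` at the head, `−1` at the tail) and the augmentation is
`ε(v) = Σ_x v_x`.  THEOREM (`exists_finsupp_fixedPoints_boundary_eq_of_sum_eq_zero`): `ε(v) = 0 ⇒ ∃ c, ∂c = v`.  PROOF — LEAF PEELING, no contracting homotopy: root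
the tree at any `r` (★ `TreeLayers.exists_rooted_parent`) and induct on the potential `Σ_{x ∈ supp v} (dist(r,x) + 1)`.  Take `x ∈ supp v` of MAXIMAL depth; if `x = r`
then `supp v = {r}` and `v_r = ε(v) = 0`.  Otherwise let `y` be the parent of `x`.  KEY TREE LEMMA (`dist_eq_dist_parent_add_one_of_not_shadow` ∕ `_of_depth_le`): a vertex `z` NOT in
the shadow `{w | dist(r,w) = dist(r,x) + dist(x,w)}` of `x` is reached from `x` through `y`: `dist(x,z) = dist(y,z) + 1` (a geodesic from `x` whose first step is a CHILD
stays in the shadow — induction on the distance with ★ (P5)); every other support vertex `z` has depth `≤` that of `x`, so is not in the shadow.  KEY ALGEBRA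
(`apply_mem_fixedPoints_sup_of_forall_dist`): `v_x = e_x v_x = −Σ_{z ≠ x} e_x v_z` and for each such `z`, by (U7) `U_y ⊆ U_x U_z` and ★ row 33 §4 then §2,
`e_x v_z = e_x (e_y v_z) = e_{U_x ⊔ U_y} v_z ∈ V^{U_x ⊔ U_y}`; so `v_x ∈ V^{U_x ⊔ U_y} = V^{U_e}`, `e = {x, y}`.  Then `v′ := v − v_x·[x] + v_x·[y]` is a `0`-chain of the
same kind with `ε(v′) = 0` and smaller potential, `v = v′ + ∂(±v_x · [e])`; induct.  `H₁ = 0` (`finsupp_boundary_injective`) is ★ `AcyclicBoundaryInjective` verbatim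
(the sub-coefficients `V^{U_e} ⊆ V` do not matter for injectivity).

* §1 TREE LEMMAS over ★ `exists_rooted_parent`'s clause (P5) + root clause: `exists_adj_dist_succ_eq` (first step of a geodesic), **`dist_root_eq_add_of_firstStep_child`** (a geodesic
  leaving `x` through a child stays in the shadow of `x`), **`dist_eq_dist_parent_add_one_of_not_shadow`** (`z ∉ shadow(x)` ⇒ `dist(x,z) = dist(p x, z) + 1`), `dist_eq_dist_parent_add_one_of_depth_le` (the peeling vertex).
* §2 THE KEY ALGEBRA **`apply_mem_fixedPoints_sup_of_forall_dist`** — if every other support vertex `z` of `v` satisfies `dist(x,z) = dist(y,z) + 1` ((U6) at `x, y`, (U7) from `x` through `y`),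
  and `Σ v = 0`, then `v x ∈ V^{U_x ⊔ U_y}`.
* §3 BOUNDARY BOOKKEEPING: `boundary_add`, `boundary_single_edge` (`∂(m·[e]) = m·[head e] − m·[tail e]`), `exists_single_edge_boundary_eq` (for `x ~ y` and `m ∈ V^{U_x ⊔ U_y}` an
  edge chain with boundary `m·[x] − m·[y]`).
* §4 **`exists_finsupp_fixedPoints_boundary_eq_of_sum_eq_zero`** — EXACTNESS AT `C₀`; `finsupp_boundary_injective_of_isTree` — `H₁ = 0` (★, re-exported in this currency).

## References
* [SchneiderStuhler1997] P. Schneider, U. Stuhler, *Representation theory and sheaves on the Bruhat–Tits building*, Publ. Math. IHÉS 85 (1997): Thm. II.3.1 p. 123 (exactness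
  of the augmented oriented chain complex of the coefficient system `F ↦ V^{U_F^{(e)}}`), Prop. I.2.11 (ii) p. 116 and Prop. I.3.2 pp. 118–119 (the properties (U6), (U7)
  in the numbering of [Korman2004, §3.6]).
* [MeyerSolleveld2010] R. Meyer, M. Solleveld, *Resolutions for representations of reductive p-adic groups via their buildings*, J. reine angew. Math. 647 (2010): Thm. 2.4
  (exactness in positive degrees for EVERY smooth `V`, `H₀ =` the subrepresentation generated by the `U_x^{(e)}`-fixed vectors).
* [Serre1980Trees] J.-P. Serre, *Trees* (1980): I.2.3 (geodesics and the projection onto a subtree), II.1.1 (the tree of a rank-one group).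
* [Korman2004] J. Korman, *A character formula for compact elements (the rank one case)*, arXiv:math/0409292: §3.6 (U6)(U7), §4 (the complex on the tree).
-/

set_option autoImplicit false

open scoped BigOperators Pointwise
open SimpleGraph Finset
open Literature.NumberTheory.Automorphic Literature.Combinatorics.SimpleGraph Literature.Combinatorics.SimpleGraph.OrientedIncidence

/-! ## §1 Tree lemmas: the first step of a geodesic; leaving through a child stays in the shadow; otherwise the geodesic passes the parent -/

namespace Literature.Combinatorics.SimpleGraph.TreeLayers

variable {ι : Type*} {G : SimpleGraph ι}

/-- The FIRST STEP of a geodesic: for `x ≠ z` in a connected graph there is a neighbour `y` of `x` with `dist(y, z) + 1 = dist(x, z)`. [cite: Serre1980Trees, I.2.3] -/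
theorem exists_adj_dist_succ_eq (hc : G.Connected) {x z : ι} (hxz : x ≠ z) : ∃ y, G.Adj x y ∧ G.dist y z + 1 = G.dist x z := by
  obtain ⟨W, hW⟩ := hc.exists_walk_length_eq_dist x z
  cases W with
  | nil => exact absurd rfl hxz
  | cons hadj W' =>
    rename_i y
    rw [Walk.length_cons] at hW
    have h1 := dist_le W'
    have h2 : G.dist x z ≤ G.dist x y + G.dist y z := hc.dist_triangle
    have h3 : G.dist x y = 1 := dist_eq_one_iff_adj.2 hadj
    exact ⟨y, hadj, by omega⟩

/-- **A geodesic leaving `x` through a CHILD stays in the shadow of `x`.**  In a tree rooted at `r` with parent map `p` (clause (P5) of ★ `exists_rooted_parent`: a non-parent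
neighbour `w` of `v ≠ r` has `dist(r,w) = dist(r,v) + 1` and `p w = v`; the neighbours of `r` are children of `r`): if `x ~ c`, `c` is not the parent of `x` (or `x = r`),
and `dist(c, z) + 1 = dist(x, z)`, then `dist(r, z) = dist(r, x) + dist(x, z)` (induction on `dist(x, z)`: the next step from `c` is not back to `x = p c`, so it is again a
child). [cite: Serre1980Trees, I.2.3] [cite: Diestel2010, Thm. 1.5.1] -/
theorem dist_root_eq_add_of_firstStep_child (hc : G.Connected) {r : ι} {p : ι → ι}
    (hchild : ∀ v w, v ≠ r → G.Adj v w → w ≠ p v → G.dist r w = G.dist r v + 1 ∧ p w = v) (hroot : ∀ w, G.Adj r w → p w = r) :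
    ∀ (n : ℕ) {x c z : ι}, G.dist x z = n → G.Adj x c → (x = r ∨ c ≠ p x) → G.dist c z + 1 = G.dist x z → G.dist r z = G.dist r x + G.dist x z := by
  intro n
  induction n with
  | zero =>
    intro x c z hn _ _ hcz
    omega
  | succ n ih =>
    intro x c z hn hxc hcp hcz
    -- `c` is a child of `x`: `dist r c = dist r x + 1` and `p c = x`
    have hcx : G.dist r c = G.dist r x + 1 ∧ p c = x := by
      rcases hcp with hxr | hcp
      · subst hxr
        exact ⟨by rw [SimpleGraph.dist_self, dist_eq_one_iff_adj.2 hxc], hroot c hxc⟩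
      · by_cases hxr : x = r
        · subst hxr
          exact ⟨by rw [SimpleGraph.dist_self, dist_eq_one_iff_adj.2 hxc], hroot c hxc⟩
        · exact hchild x c hxr hxc hcp
    by_cases hcz0 : c = z
    · subst hcz0
      have : G.dist x c = 1 := dist_eq_one_iff_adj.2 hxc
      omega
    · -- next step of the geodesic from `c` to `z`
      obtain ⟨c₂, hcc₂, hc₂⟩ := exists_adj_dist_succ_eq hc hcz0
      have hc₂x : c₂ ≠ p c := by
        rintro rfl
        rw [hcx.2] at hc₂
        omega
      have hcr : c ≠ r := by
        intro hcr
        rw [hcr, SimpleGraph.dist_self] at hcx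
        omega
      have key := ih (x := c) (c := c₂) (z := z) (by omega) hcc₂ (Or.inr hc₂x) hc₂
      omega

/-- **Outside the shadow the geodesic passes the parent**: in a tree rooted at `r` (clause (P5) of ★ `exists_rooted_parent` and the root clause), for a vertex `x` with
parent `p x` and a vertex `z` with `dist(r, z) ≠ dist(r, x) + dist(x, z)` (i.e. `z` is not a descendant of `x`; this forces `x ≠ r`): `dist(x, z) = dist(p x, z) + 1`.
[cite: Serre1980Trees, I.2.3] [cite: Diestel2010, Thm. 1.5.1] -/
theorem dist_eq_dist_parent_add_one_of_not_shadow (hc : G.Connected) {r : ι} {p : ι → ι}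
    (hchild : ∀ v w, v ≠ r → G.Adj v w → w ≠ p v → G.dist r w = G.dist r v + 1 ∧ p w = v) (hroot : ∀ w, G.Adj r w → p w = r)
    {x z : ι} (hz : G.dist r z ≠ G.dist r x + G.dist x z) : G.dist x z = G.dist (p x) z + 1 := by
  have hxz : x ≠ z := by
    rintro rfl
    rw [SimpleGraph.dist_self, add_zero] at hz
    exact hz rfl
  obtain ⟨c, hxc, hcz⟩ := exists_adj_dist_succ_eq hc hxz
  by_cases hcp : c = p x
  · rw [← hcp]; omega
  · exact absurd (dist_root_eq_add_of_firstStep_child hc hchild hroot _ rfl hxc (Or.inr hcp) hcz) hz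

/-- **THE PEELING VERTEX.**  In a tree rooted at `r`, if `z ≠ x` is not deeper than `x` (`dist(r, z) ≤ dist(r, x)`) then `z` is reached from `x` through the parent:
`dist(x, z) = dist(p x, z) + 1` (a descendant `z ≠ x` of `x` would be deeper) — applied to a support vertex `x` of MAXIMAL depth and every other support vertex `z`.
[cite: Serre1980Trees, I.2.3] [cite: Diestel2010, Thm. 1.5.1] -/
theorem dist_eq_dist_parent_add_one_of_depth_le (hc : G.Connected) {r : ι} {p : ι → ι}
    (hchild : ∀ v w, v ≠ r → G.Adj v w → w ≠ p v → G.dist r w = G.dist r v + 1 ∧ p w = v) (hroot : ∀ w, G.Adj r w → p w = r)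
    {x z : ι} (hzx : z ≠ x) (hle : G.dist r z ≤ G.dist r x) : G.dist x z = G.dist (p x) z + 1 := by
  refine dist_eq_dist_parent_add_one_of_not_shadow hc hchild hroot fun h => hzx ?_
  have h0 : G.dist x z = 0 := by omega
  exact ((hc.dist_eq_zero_iff).1 h0).symm

end Literature.Combinatorics.SimpleGraph.TreeLayers

/-! ## §2 The key algebra: the coefficient at a peeling vertex is fixed by the edge group -/

namespace Representation

open Literature.Combinatorics.SimpleGraph.TreeLayers

variable {k Γ V : Type*} [Field k] [CharZero k] [Group Γ] [TopologicalSpace Γ] [IsTopologicalGroup Γ]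
  [AddCommGroup V] [Module k V] {ρ : Representation k Γ V}
variable {ι : Type*} {G : SimpleGraph ι}

/-- **THE KEY ALGEBRA.**  Let `U : ι → Subgroup Γ` be compact vertex groups with (U6) at the edge `x ~ y` (`↑(U_x ⊔ U_y) = U_x · U_y`) and (U7) from `x` through `y`
(`U_y ⊆ U_x · U_z` whenever `dist(y,z) + 1 = dist(x,z)`), and let `v : ι →₀ V` be a `0`-chain (`v_z ∈ V^{U_z}` smooth) with `Σ_z v_z = 0` such that every support vertex
`z ≠ x` satisfies `dist(x, z) = dist(y, z) + 1`.  Then `v_x ∈ V^{U_x ⊔ U_y}`: indeed `v_x = e_x v_x = −Σ_{z ≠ x} e_x v_z` and `e_x v_z = e_x (e_y v_z) = e_{U_x ⊔ U_y} v_z`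
(★ row 33 §4, §2). [cite: SchneiderStuhler1997, Ch. II §3 p. 123] [cite: MeyerSolleveld2010, Thm. 2.4] -/
theorem apply_mem_fixedPoints_sup_of_forall_dist [DecidableEq ι] (U : ι → Subgroup Γ) (hU : ∀ z, IsCompact (U z : Set Γ)) {x y : ι}
    (hU6 : ((U x ⊔ U y : Subgroup Γ) : Set Γ) = (U x : Set Γ) * (U y : Set Γ))
    (hU7 : ∀ z, G.dist y z + 1 = G.dist x z → ((U y : Subgroup Γ) : Set Γ) ⊆ (U x : Set Γ) * (U z : Set Γ))
    (v : ι →₀ V) (hfix : ∀ z, v z ∈ ρ.fixedPoints (U z)) (hsm : ∀ z, ρ.IsSmoothVector (v z)) (hsum : v.sum (fun _ m => m) = 0)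
    (hdist : ∀ z ∈ v.support, z ≠ x → G.dist x z = G.dist y z + 1) : v x ∈ ρ.fixedPoints (U x ⊔ U y) := by
  classical
  -- `v x = - Σ_{z ∈ supp ∖ {x}} v z`
  have hsplit : v x = -∑ z ∈ v.support.erase x, v z := by
    rw [eq_neg_iff_add_eq_zero]
    by_cases hx : x ∈ v.support
    · rw [Finset.add_sum_erase _ _ hx]
      simpa [Finsupp.sum] using hsum
    · have hx0 : v x = 0 := Finsupp.notMem_support_iff.1 hx
      rw [hx0, zero_add, Finset.erase_eq_of_notMem hx]
      simpa [Finsupp.sum] using hsum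
  -- each `e_x (v z)`, `z ≠ x` in the support, lies in `V^{U_x ⊔ U_y}`
  have hterm : ∀ z ∈ v.support.erase x, ρ.avgProj (U x) (v z) ∈ ρ.fixedPoints (U x ⊔ U y) := by
    intro z hz
    obtain ⟨hzx, hzs⟩ := Finset.mem_erase.1 hz
    have hd : G.dist x z = G.dist y z + 1 := hdist z hzs hzx
    have hsub : ((U y : Subgroup Γ) : Set Γ) ⊆ (U x : Set Γ) * (U z : Set Γ) := hU7 z hd.symm
    have h1 : ρ.avgProj (U x) (ρ.avgProj (U y) (v z)) = ρ.avgProj (U x) (v z) :=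
      avgProj_avgProj_eq_avgProj_of_subset_mul (hU x) (hU y) hsub (hsm z) (hfix z)
    rw [← h1, avgProj_avgProj_eq_avgProj_sup (hU x) (hU y) hU6 (hsm z)]
    exact avgProj_mem_fixedPoints (isCompact_coe_sup_of_coe_sup_eq_mul (hU x) (hU y) hU6) (hsm z)
  -- assemble: `v x = e_x (v x) = -Σ e_x (v z)`
  have hex : ρ.avgProj (U x) (v x) = v x := avgProj_of_mem_fixedPoints (hU x) (hsm x) (hfix x)
  rw [← hex, hsplit, ← neg_one_smul k, avgProj_smul (hU x) _ (isSmoothVector_finset_sum _ _ fun z _ => hsm z),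
    avgProj_finset_sum (hU x) _ _ fun z _ => hsm z]
  exact Submodule.smul_mem _ _ (Submodule.sum_mem _ hterm)

/-! ## §3 Boundary bookkeeping for finitely supported `1`-chains with coefficients in `V` -/

section Boundary

variable [DecidableEq ι] (σ : Orientation G)

omit [CharZero k] [TopologicalSpace Γ] [IsTopologicalGroup Γ] in
/-- The boundary `c ↦ (u ↦ Σ_e D_{ue} • c_e)` is additive. [cite: GodsilRoyle2001, §8.3 (p. 167)] -/
theorem boundary_add (c c' : G.edgeSet →₀ V) (u : ι) :
    ((c + c').sum fun e m => σ.incMatrix k u e • m) = (c.sum fun e m => σ.incMatrix k u e • m) + (c'.sum fun e m => σ.incMatrix k u e • m) :=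
  Finsupp.sum_add_index' (fun _ => smul_zero _) (fun _ _ _ => smul_add _ _ _)

omit [CharZero k] [TopologicalSpace Γ] [IsTopologicalGroup Γ] in
/-- The boundary of an edge chain `m·[e]`: `+m` at the head, `−m` at the tail, `0` elsewhere. [cite: GodsilRoyle2001, §8.3 (p. 167)] [cite: Biggs1974, Definition 4.2] -/
theorem boundary_single_edge (e : G.edgeSet) (m : V) (u : ι) :
    ((Finsupp.single e m).sum fun e' m' => σ.incMatrix k u e' • m') = (if u = σ.head e then m else 0) - (if u = σ.tail e then m else 0) := by
  rw [Finsupp.sum_single_index (h := fun e' m' => σ.incMatrix k u e' • m') (smul_zero _)]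
  change σ.incMatrix k u e • m = _
  rw [Orientation.incMatrix_apply, sub_smul]
  congr 1 <;> split_ifs <;> simp

omit [CharZero k] in
/-- For adjacent `x ~ y` and `m ∈ V^{U_x ⊔ U_y}` there is an edge chain `c` supported on `{x, y}` with coefficient in `V^{U_{head} ⊔ U_{tail}}` and boundary `m·[x] − m·[y]`
(orient `m` with the sign of the edge). [cite: SchneiderStuhler1997, Ch. II §3 p. 123] -/
theorem exists_single_edge_boundary_eq (U : ι → Subgroup Γ) {x y : ι} (hxy : G.Adj x y) {m : V} (hm : m ∈ ρ.fixedPoints (U x ⊔ U y))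
    (hms : ρ.IsSmoothVector m) :
    ∃ c : G.edgeSet →₀ V, (∀ e, c e ∈ ρ.fixedPoints (U (σ.head e) ⊔ U (σ.tail e))) ∧ (∀ e, ρ.IsSmoothVector (c e)) ∧
      ∀ u, (c.sum fun e m' => σ.incMatrix k u e • m') = (Finsupp.single x m - Finsupp.single y m) u := by
  set e₀ : G.edgeSet := ⟨s(x, y), hxy⟩
  rcases σ.head_tail_of_adj hxy with ⟨hh, ht⟩ | ⟨hh, ht⟩
  · refine ⟨Finsupp.single e₀ m, fun e => ?_, fun e => ?_, fun u => ?_⟩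
    · by_cases he : e = e₀
      · subst he; rw [Finsupp.single_eq_same, hh, ht]; exact hm
      · rw [Finsupp.single_eq_of_ne he]; exact Submodule.zero_mem _
    · by_cases he : e = e₀
      · subst he; rw [Finsupp.single_eq_same]; exact hms
      · rw [Finsupp.single_eq_of_ne he]; exact ρ.isSmoothVector_zero
    · rw [boundary_single_edge, hh, ht, Finsupp.sub_apply, Finsupp.single_apply, Finsupp.single_apply]
      simp only [eq_comm]
  · refine ⟨Finsupp.single e₀ (-m), fun e => ?_, fun e => ?_, fun u => ?_⟩
    · by_cases he : e = e₀
      · subst he; rw [Finsupp.single_eq_same, hh, ht, sup_comm]; exact Submodule.neg_mem _ hm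
      · rw [Finsupp.single_eq_of_ne he]; exact Submodule.zero_mem _
    · by_cases he : e = e₀
      · subst he; rw [Finsupp.single_eq_same, ← neg_one_smul k]; exact IsSmoothVector.smul ρ _ hms
      · rw [Finsupp.single_eq_of_ne he]; exact ρ.isSmoothVector_zero
    · rw [boundary_single_edge, hh, ht, Finsupp.sub_apply, Finsupp.single_apply, Finsupp.single_apply]
      by_cases hux : u = x <;> by_cases huy : u = y
      · exact absurd (hux.symm.trans huy) hxy.ne
      · subst hux; simp [huy, Ne.symm huy]
      · subst huy; simp [hux, Ne.symm hux]
      · simp [hux, huy, Ne.symm hux, Ne.symm huy]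

end Boundary

/-! ## §4 Exactness at `C₀` and `H₁ = 0` -/

/-- **THE SCHNEIDER–STUHLER COMPLEX ON A TREE IS EXACT AT `C₀`.**  `G` a tree, `U : ι → Subgroup Γ` compact with (U6) `↑(U_x ⊔ U_y) = U_x · U_y` on edges and (U7)
`U_y ⊆ U_x · U_z` for `x ~ y`, `dist(y,z) + 1 = dist(x,z)`; then every finitely supported `0`-chain `v` (`v_x ∈ V^{U_x}` smooth) with `Σ_x v_x = 0` is a boundary:
`v = ∂c` for a finitely supported `1`-chain `c` with `c_e ∈ V^{U_{head e} ⊔ U_{tail e}}` smooth (leaf peeling from a vertex of maximal depth, §1–§3).  Valid for EVERY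
representation on its smooth vectors (no level-`e` generation hypothesis). [cite: SchneiderStuhler1997, Thm. II.3.1 p. 123] [cite: MeyerSolleveld2010, Thm. 2.4] -/
theorem exists_finsupp_fixedPoints_boundary_eq_of_sum_eq_zero [DecidableEq ι] (hT : G.IsTree) (σ : Orientation G)
    (U : ι → Subgroup Γ) (hU : ∀ z, IsCompact (U z : Set Γ))
    (hU6 : ∀ x y, G.Adj x y → ((U x ⊔ U y : Subgroup Γ) : Set Γ) = (U x : Set Γ) * (U y : Set Γ))
    (hU7 : ∀ x y z, G.Adj x y → G.dist y z + 1 = G.dist x z → ((U y : Subgroup Γ) : Set Γ) ⊆ (U x : Set Γ) * (U z : Set Γ))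
    (v : ι →₀ V) (hfix : ∀ z, v z ∈ ρ.fixedPoints (U z)) (hsm : ∀ z, ρ.IsSmoothVector (v z)) (hsum : v.sum (fun _ m => m) = 0) :
    ∃ c : G.edgeSet →₀ V, (∀ e, c e ∈ ρ.fixedPoints (U (σ.head e) ⊔ U (σ.tail e))) ∧ (∀ e, ρ.IsSmoothVector (c e)) ∧
      ∀ u, (c.sum fun e m => σ.incMatrix k u e • m) = v u := by
  classical
  -- empty support: `c = 0`
  by_cases hv0 : v = 0
  · subst hv0
    exact ⟨0, fun _ => Submodule.zero_mem _, fun _ => ρ.isSmoothVector_zero, fun u => by simp⟩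
  obtain ⟨r, hr⟩ : ∃ r, r ∈ v.support := Finset.nonempty_iff_ne_empty.2 (by rwa [Ne, Finsupp.support_eq_empty]) |>.exists_mem
  have hc : G.Connected := hT.1
  obtain ⟨p, hpar, hchild, hroot, -⟩ := exists_rooted_parent hT r
  -- induction on the potential `Φ(v) = Σ_{z ∈ supp v} (dist(r,z) + 1)`
  suffices key : ∀ (n : ℕ) (w : ι →₀ V), (∑ z ∈ w.support, (G.dist r z + 1)) ≤ n → (∀ z, w z ∈ ρ.fixedPoints (U z)) → (∀ z, ρ.IsSmoothVector (w z)) →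
      w.sum (fun _ m => m) = 0 → ∃ c : G.edgeSet →₀ V, (∀ e, c e ∈ ρ.fixedPoints (U (σ.head e) ⊔ U (σ.tail e))) ∧ (∀ e, ρ.IsSmoothVector (c e)) ∧
        ∀ u, (c.sum fun e m => σ.incMatrix k u e • m) = w u from
    key _ v le_rfl hfix hsm hsum
  intro n
  induction n with
  | zero =>
    intro w hΦ hwfix hwsm hwsum
    have hsupp : w.support = ∅ := by
      by_contra hne
      obtain ⟨z, hz⟩ := Finset.nonempty_iff_ne_empty.2 hne
      have := Finset.single_le_sum (f := fun z => G.dist r z + 1) (fun _ _ => Nat.zero_le _) hz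
      omega
    have hw0 : w = 0 := Finsupp.support_eq_empty.1 hsupp
    subst hw0
    exact ⟨0, fun _ => Submodule.zero_mem _, fun _ => ρ.isSmoothVector_zero, fun u => by simp⟩
  | succ n ih =>
    intro w hΦ hwfix hwsm hwsum
    by_cases hw0 : w = 0
    · subst hw0
      exact ⟨0, fun _ => Submodule.zero_mem _, fun _ => ρ.isSmoothVector_zero, fun u => by simp⟩
    have hne : w.support.Nonempty := Finset.nonempty_iff_ne_empty.2 (by rwa [Ne, Finsupp.support_eq_empty])
    -- a support vertex of maximal depth
    obtain ⟨x, hx, hxmax⟩ := Finset.exists_max_image w.support (fun z => G.dist r z) hne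
    by_cases hxr : x = r
    · -- then the support is `{r}` and `w r = Σ w = 0`: contradiction with `r ∈ supp`
      exfalso
      have hsub : w.support ⊆ {r} := by
        intro z hz
        have hz0 : G.dist r z = 0 := by
          have := hxmax z hz
          rw [hxr, SimpleGraph.dist_self] at this
          omega
        exact Finset.mem_singleton.2 ((hc.dist_eq_zero_iff.1 hz0).symm)
      have hwr : w r = 0 := by
        have : w.sum (fun _ m => m) = ∑ z ∈ {r}, w z := by
          rw [Finsupp.sum]
          exact Finset.sum_subset hsub fun z _ hz => Finsupp.notMem_support_iff.1 hz
        rw [this, Finset.sum_singleton] at hwsum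
        exact hwsum
      rw [hxr] at hx
      exact (Finsupp.mem_support_iff.1 hx) hwr
    -- the parent `y` of `x`
    obtain ⟨hxy, hdy⟩ := hpar x hxr
    set y := p x with hy
    -- the key algebra: `w x ∈ V^{U_x ⊔ U_y}`
    have hmem : w x ∈ ρ.fixedPoints (U x ⊔ U y) :=
      apply_mem_fixedPoints_sup_of_forall_dist (G := G) U hU (hU6 x y hxy) (fun z hz => hU7 x y z hxy hz) w hwfix hwsm hwsum
        fun z hz hzx => dist_eq_dist_parent_add_one_of_depth_le hc hchild hroot hzx (hxmax z hz)
    -- peel: `w' = w - w x·[x] + w x·[y]`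
    set w' : ι →₀ V := w - Finsupp.single x (w x) + Finsupp.single y (w x) with hw'
    have hyx : y ≠ x := fun h => hxy.ne h.symm
    have hw'x : w' x = 0 := by
      simp [hw', hyx]
    have hw'y : w' y = w y + w x := by
      simp [hw', hyx.symm]
    have hw'z : ∀ z, z ≠ x → z ≠ y → w' z = w z := fun z hzx hzy => by
      simp [hw', Ne.symm hzx, Ne.symm hzy]
    have hw'fix : ∀ z, w' z ∈ ρ.fixedPoints (U z) := by
      intro z
      by_cases hzx : z = x
      · rw [hzx, hw'x]; exact Submodule.zero_mem _
      · by_cases hzy : z = y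
        · rw [hzy, hw'y]
          exact Submodule.add_mem _ (hwfix y) (ρ.fixedPoints_antitone (le_sup_right : U y ≤ U x ⊔ U y) hmem)
        · rw [hw'z z hzx hzy]; exact hwfix z
    have hw'sm : ∀ z, ρ.IsSmoothVector (w' z) := by
      intro z
      by_cases hzx : z = x
      · rw [hzx, hw'x]; exact ρ.isSmoothVector_zero
      · by_cases hzy : z = y
        · rw [hzy, hw'y]; exact IsSmoothVector.add ρ (hwsm y) (hwsm x)
        · rw [hw'z z hzx hzy]; exact hwsm z
    have hw'sum : w'.sum (fun _ m => m) = 0 := by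
      have h1 : (w - Finsupp.single x (w x) + Finsupp.single y (w x)).sum (fun _ m => m)
          = w.sum (fun _ m => m) - (Finsupp.single x (w x)).sum (fun _ m => m) + (Finsupp.single y (w x)).sum (fun _ m => m) := by
        rw [Finsupp.sum_add_index' (fun _ => rfl) (fun _ _ _ => rfl), Finsupp.sum_sub_index (fun _ _ _ => rfl)]
      rw [hw', h1, hwsum, Finsupp.sum_single_index rfl, Finsupp.sum_single_index rfl, zero_sub, neg_add_cancel]
    -- the potential drops
    have hsupp' : w'.support ⊆ insert y (w.support.erase x) := by
      intro z hz
      rw [Finset.mem_insert, Finset.mem_erase]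
      by_cases hzy : z = y
      · exact Or.inl hzy
      · right
        have hzx : z ≠ x := by
          rintro rfl
          exact (Finsupp.mem_support_iff.1 hz) hw'x
        refine ⟨hzx, ?_⟩
        rw [Finsupp.mem_support_iff] at hz ⊢
        rwa [hw'z z hzx hzy] at hz
    have hΦ' : (∑ z ∈ w'.support, (G.dist r z + 1)) ≤ n := by
      have h1 : (∑ z ∈ w'.support, (G.dist r z + 1)) ≤ ∑ z ∈ insert y (w.support.erase x), (G.dist r z + 1) :=
        Finset.sum_le_sum_of_subset_of_nonneg hsupp' fun _ _ _ => Nat.zero_le _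
      have h2 : (∑ z ∈ insert y (w.support.erase x), (G.dist r z + 1)) ≤ (G.dist r y + 1) + ∑ z ∈ w.support.erase x, (G.dist r z + 1) := by
        by_cases hyin : y ∈ w.support.erase x
        · rw [Finset.insert_eq_of_mem hyin]; omega
        · rw [Finset.sum_insert hyin]
      have h3 : (∑ z ∈ w.support.erase x, (G.dist r z + 1)) + (G.dist r x + 1) = ∑ z ∈ w.support, (G.dist r z + 1) :=
        Finset.sum_erase_add _ _ hx
      omega
    -- induct and add the edge chain
    obtain ⟨c', hc'fix, hc'sm, hc'bd⟩ := ih w' hΦ' hw'fix hw'sm hw'sum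
    obtain ⟨c₀, hc₀fix, hc₀sm, hc₀bd⟩ := exists_single_edge_boundary_eq σ U hxy hmem (hwsm x)
    refine ⟨c' + c₀, fun e => Submodule.add_mem _ (hc'fix e) (hc₀fix e), fun e => IsSmoothVector.add ρ (hc'sm e) (hc₀sm e), fun u => ?_⟩
    rw [boundary_add, hc'bd, hc₀bd, hw']
    simp only [Finsupp.add_apply, Finsupp.sub_apply]
    abel

omit [CharZero k] [TopologicalSpace Γ] [IsTopologicalGroup Γ] in
/-- **`H₁ = 0`: the boundary is injective on finitely supported `1`-chains** (a tree is a forest; ★ `AcyclicBoundaryInjective.finsupp_boundary_injective_of_isAcyclic`, re-exported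
in the currency of this file — the sub-coefficients `V^{U_e} ⊆ V` play no role). [cite: SchneiderStuhler1997, Thm. II.3.1 p. 123] [cite: Biggs1974, Theorem 4.5 with Ch. 7] -/
theorem finsupp_boundary_injective_of_isTree [DecidableEq ι] (hT : G.IsTree) (σ : Orientation G) :
    Function.Injective fun c : G.edgeSet →₀ V => fun u : ι => (c.sum fun e m => σ.incMatrix k u e • m) :=
  σ.finsupp_boundary_injective_of_isAcyclic k hT.2

end Representation
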